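import Mathlib.GroupTheory.Index
import Literature.GroupTheory.CombinatorialGroupTheory.SurfaceGroupConjugacySeparable
import Literature.IUT.HodgeTheaters.SurfaceGroupBridge
import Literature.IUT.HodgeTheaters.DiscreteProfiniteConjugatesFreeGroupLemmas
import HarnessLib

/-!
# Finite-index subgroups of orientable surface groups — the [IUTchI] consumer shapes

S. Mochizuki, *Inter-universal Teichmüller Theory I*, §2, Theorem 2.6 / Lemma 2.7 (kurims pp. 56–59)
[claim: Mochizuki2012, status: disputed] work with "a group `G` as in Theorem 2.6": free of finite rank
or an ORIENTABLE SURFACE GROUP (`Literature.IUT.HodgeTheaters.IsOrientableSurfaceGroup`: `G ≃* S_g`,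
`g ≥ 2`), and repeatedly "replace `G` by an appropriate finite index subgroup of `G`" (p. 57, ll. 1,
12; p. 59, proof of (vi): "the profinite completion `Ĝ₁ ⊆ Ĝ` of `G₁`"). That the class is closed
under finite-index subgroups is, on the surface side, the classical Riemann–Hurwitz fact typed as the
NAMED FACT `Literature.GroupTheory.CombinatorialGroupTheory.SurfaceGroupFiniteIndexSubgroup`
(Zieschang–Vogt–Coldewey LNM 835, Thm. 4.14.22 / Prop. 4.14.23; seat abc-iut-L5-d2,
`SurfaceGroupConjugacySeparable.lean`), stated over the tree's `FourManifolds.SurfaceGroup`.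

This proof-only file transports it to the [IUTchI] vocabulary through the presentation bridge
`exists_mulEquiv_surfaceGroup` (`SurfaceGroupBridge.lean`, seat abc-iut-L5-d1), so that the
surface-half consumers (Lem. 2.7 (v)–(vii), Thm. 2.6, Cor. 2.8) can invoke, BY NAME and under the
hypothesis `(hF : SurfaceGroupFiniteIndexSubgroup)`:

* `IsOrientableSurfaceGroup.exists_genus_subgroup` — genus bookkeeping `h = [G:H]·(g-1)+1` with both
  isomorphisms `G ≃* S_g`, `H ≃* S_h`;
* `IsOrientableSurfaceGroup.subgroup_of_finiteIndex` — a finite-index subgroup of an orientable surface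
  group is an orientable surface group (genus again `≥ 2`);
* `IsFreeOrSurface.subgroup_of_finiteIndex` — the class "free of finite rank or orientable surface"
  of Lemma 2.7 is closed under finite-index subgroups (free side unconditional: seat abc-iut-L5-t9's
  `FreeOrSurface.isFreeOfFiniteRank_subgroup_of_finiteIndex`, Nielsen–Schreier + Schreier's lemma).

Theorems only; no statement of the paper is strengthened; the fact stays a hypothesis (typed ≠ proved).
-/

namespace Literature.IUT.HodgeTheaters

open Literature.GroupTheory.CombinatorialGroupTheory

universe u

/-- Transport of the Riemann–Hurwitz fact to an abstract orientable surface group: for `G ≃* S_g`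
(`g ≥ 2`) and `H ≤ G` of finite index there is `h = [G:H]·(g-1)+1` with `H ≃* S_h` (both surface
groups in the [IUTchI] presentation `Fin g ⊕ Fin g`), GRANTED the named fact
`SurfaceGroupFiniteIndexSubgroup`. [cite: ZieschangVogtColdewey1980, §4.14 Prop 4.14.23] -/
theorem IsOrientableSurfaceGroup.exists_genus_subgroup (hF : SurfaceGroupFiniteIndexSubgroup)
    {G : Type u} [Group G] (hG : IsOrientableSurfaceGroup G) (H : Subgroup G) [H.FiniteIndex] :
    ∃ g h : ℕ, 2 ≤ g ∧ h = H.index * (g - 1) + 1 ∧ Nonempty (G ≃* SurfaceGroup g) ∧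
      Nonempty (H ≃* SurfaceGroup h) := by
  obtain ⟨g, hg, ⟨e₁⟩⟩ := hG
  obtain ⟨e₂⟩ := exists_mulEquiv_surfaceGroup g
  let e : G ≃* Literature.Topology.FourManifolds.SurfaceGroup g := e₁.trans e₂
  let K : Subgroup (Literature.Topology.FourManifolds.SurfaceGroup g) :=
    H.map (e : G →* Literature.Topology.FourManifolds.SurfaceGroup g)
  have hKi : K.index = H.index := Subgroup.index_map_of_bijective e.bijective H
  haveI : K.FiniteIndex := ⟨by rw [hKi]; exact Subgroup.FiniteIndex.index_ne_zero⟩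
  obtain ⟨h, hh, ⟨e₃⟩⟩ := hF g hg K inferInstance
  obtain ⟨e₄⟩ := exists_mulEquiv_surfaceGroup h
  exact ⟨g, h, hg, by rw [hh, hKi], ⟨e₁⟩, ⟨((e.subgroupMap H).trans e₃).trans e₄.symm⟩⟩

/-- **A finite-index subgroup of an orientable surface group is an orientable surface group**
([IUTchI] Thm. 2.6 / Lem. 2.7: "replacing `G` by an appropriate finite index subgroup of `G`", p. 57),
GRANTED the named fact `SurfaceGroupFiniteIndexSubgroup` (Riemann–Hurwitz; the new genus
`[G:H]·(g-1)+1` is again `≥ 2`). [cite: ZieschangVogtColdewey1980, §4.14 Prop 4.14.23] -/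
theorem IsOrientableSurfaceGroup.subgroup_of_finiteIndex (hF : SurfaceGroupFiniteIndexSubgroup)
    {G : Type u} [Group G] (hG : IsOrientableSurfaceGroup G) (H : Subgroup G) [H.FiniteIndex] :
    IsOrientableSurfaceGroup H := by
  obtain ⟨g, h, hg, hh, -, ⟨e⟩⟩ := hG.exists_genus_subgroup hF H
  exact ⟨h, two_le_genus_of_index hg Subgroup.FiniteIndex.index_ne_zero hh, ⟨e⟩⟩

/-- The class "free of finite rank or orientable surface group" of [IUTchI] Lemma 2.7 ("a group as
in Theorem 2.6") is closed under finite-index subgroups, GRANTED `SurfaceGroupFiniteIndexSubgroup` for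
the surface side. [cite: ZieschangVogtColdewey1980, §4.14 Prop 4.14.23] -/
theorem IsFreeOrSurface.subgroup_of_finiteIndex (hF : SurfaceGroupFiniteIndexSubgroup)
    {G : Type u} [Group G] (hG : IsFreeOrSurface G) (H : Subgroup G) [H.FiniteIndex] :
    IsFreeOrSurface H := by
  rcases hG with hfree | hsurf
  · exact Or.inl (FreeOrSurface.isFreeOfFiniteRank_subgroup_of_finiteIndex G hfree H)
  · exact Or.inr (hsurf.subgroup_of_finiteIndex hF H)

end Literature.IUT.HodgeTheaters
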